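import Mathlib
import Literature.Probability.Percolation.KozmaNitzanGoodQuadruple
import HarnessLib

/-!
# `NoHeavyLowerTail` (stmt-CriticalPhenomena-4575) — the observer UNION BOUND over the first open edge
# ("one-step peeling costs the weighted degree of the observer")

Lead seat `prim-nh-lead-4575` gen 6, 2026-08-19 (`--supports stmt-CriticalPhenomena-4575`).  No definitions, no named
facts, no sorries.

Finite weighted graph on `Fin n` (`μ = prodBernoulli w`), relay set `A`, observer `o ∉ A`,
`N_o = |C(o) ∩ A|`.  For a vertex `x ≠ o` write `N^{off o}_x = |{a ∈ A : x ↔ a by an open path avoiding o}|`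
— the relay count of `x` in `H := G − o` (the tree's `restrW {o}ᶜ w`, `KNGoodAux.restrW_real_eq`).

* `lowerTail_subset_biUnion_firstEdge` — **event inclusion**: `{1 ≤ N_o ≤ j} ⊆ ⋃_{x ≠ o} ({s(o,x) open} ∩
  {1 ≤ N^{off o}_x ≤ j})`.  (Cut an open path `o → a` at its first edge `s(o,x)`: the rest avoids `o`
  (`KNPreFKG.walk_decomp`), so `N^{off o}_x ≥ 1`; and every relay joined to `x` off `o` is joined to `o`,
  so `N^{off o}_x ≤ N_o ≤ j`.)
* `lowerTail_le_sum_firstEdge` — **the union bound**, by independence of the pair `s(o,x)` from the pairs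
  off `o`:  `μ(1 ≤ N_o ≤ j) ≤ Σ_{x ≠ o} w(o,x) · μ(1 ≤ N^{off o}_x ≤ j)`.
* `lowerTail_le_sum_firstEdge_restrW` — the same with the right-hand side written in `H = G − o`:
  `μ_w(1 ≤ N_o ≤ j) ≤ Σ_{x ≠ o} w(o,x) · μ_{restrW {o}ᶜ w}(1 ≤ N_x ≤ j)`.

READING (lead memo LEAD-GEN6 §3b).  This is the elementary "first-edge decomposition" of the lower tail:
the observer's small-pocket probability is at most the `w(o,·)`-weighted SUM of its neighbours' small-
pocket probabilities measured in `G − o`.  It is recorded as the BASELINE every depth-uniform argument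
must beat: iterating it along a Steiner tree multiplies by the weighted degree at every level (factor
`deg_w` per level), whereas the crux needs a bound uniform in the depth.  Combined with hypothesis-free
CIL theorems for the neighbours in `G − o` (relays: pair counting; starts of Steiner paths with relay
hairs: `cil_steinerPath`) it settles, e.g., SPIDERS — `o` the centre of `r` Steiner legs of any length —
with a constant linear in `r` (see the memo; not formalised here).
-/

namespace Summit.CriticalPhenomena.PercolationContinuityZ3.Theorems

open MeasureTheory Set
open Literature.Probability.LatticeModels (prodBernoulli prodBernoulli_real_setOf_mem
  prodBernoulli_real_inter_of_determinedBy)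
open Literature.Probability.Percolation

noncomputable section
open Classical

variable {n : ℕ}

namespace ObserverUnionBound

/-- Every configuration lies in the star event of its own set of open pairs at `o`. [folklore] -/
theorem mem_starEvent_self (o : Fin n) (ω : BondConfig (Fin n)) :
    ω ∈ starEvent o {u : Fin n | s(o, u) ∈ ω} := by
  rw [mem_starEvent_iff]
  intro u _
  exact Iff.rfl

/-- If the pair `s(o,x)` is open and `x ↔ a` off `o`, then `o ↔ a`. [folklore] -/
theorem openConn_of_edge_of_openConnIn {ω : BondConfig (Fin n)} {o x a : Fin n} (hxo : x ≠ o)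
    (he : s(o, x) ∈ ω) (h : ω ∈ openConnIn ({o}ᶜ : Set (Fin n)) x a) : ω ∈ openConn o a := by
  have hadj : (openGraph ω).Adj o x := (openGraph_adj ω o x).2 ⟨he, hxo.symm⟩
  exact hadj.reachable.trans (KNPreFKG.reachable_of_openConnIn h)

/-- **Event inclusion (first-edge decomposition of the lower tail).**  For `o ∉ A`:
`{1 ≤ N_o ≤ j} ⊆ ⋃_{x ≠ o} ({s(o,x) open} ∩ {1 ≤ N^{off o}_x ≤ j})`. [this work] -/
theorem lowerTail_subset_biUnion_firstEdge (A : Finset (Fin n)) (o : Fin n) (ho : o ∉ A) (j : ℕ) :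
    {ω : BondConfig (Fin n) | 1 ≤ (A.filter fun a => ω ∈ openConn o a).card ∧ (A.filter fun a => ω ∈ openConn o a).card ≤ j} ⊆ ⋃ x ∈ (Finset.univ.filter fun x : Fin n => x ≠ o),
      ({ω : BondConfig (Fin n) | s(o, x) ∈ ω} ∩ {ω : BondConfig (Fin n) | 1 ≤ (A.filter fun a => ω ∈ openConnIn ({o}ᶜ : Set (Fin n)) x a).card ∧ (A.filter fun a => ω ∈ openConnIn ({o}ᶜ : Set (Fin n)) x a).card ≤ j}) := by
  intro ω hω
  obtain ⟨h1, hj⟩ := hω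
  -- a relay joined to `o`
  obtain ⟨a, ha⟩ := Finset.card_pos.1 h1
  rw [Finset.mem_filter] at ha
  obtain ⟨haA, hoa⟩ := ha
  have hao : a ≠ o := fun h => ho (h ▸ haA)
  -- cut the open path at its first edge
  obtain ⟨p⟩ := (hoa : (openGraph ω).Reachable o a)
  obtain ⟨x, hxB, hxo, hxa⟩ := (KNPreFKG.walk_decomp (mem_starEvent_self o ω) p hao).2 rfl
  have hxB' : s(o, x) ∈ ω := hxB
  rw [Set.mem_iUnion₂]
  refine ⟨x, Finset.mem_filter.2 ⟨Finset.mem_univ _, hxo⟩, hxB', ?_⟩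
  -- the off-`o` relays of `x` are relays of `o`
  have hsub : (A.filter fun a' => ω ∈ openConnIn ({o}ᶜ : Set (Fin n)) x a') ⊆
      (A.filter fun a' => ω ∈ openConn o a') := by
    intro a' ha'
    rw [Finset.mem_filter] at ha' ⊢
    exact ⟨ha'.1, openConn_of_edge_of_openConnIn hxo hxB' ha'.2⟩
  refine ⟨Finset.card_pos.2 ⟨a, Finset.mem_filter.2 ⟨haA, hxa⟩⟩, ?_⟩
  exact (Finset.card_le_card hsub).trans hj

/-- The off-`o` lower-tail event `{1 ≤ N^{off o}_x ≤ j}` reads only the pairs off `o`. [this work] -/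
theorem determinedBy_lowerTailOff (A : Finset (Fin n)) (o x : Fin n) (j : ℕ) :
    DeterminedBy ({ω : BondConfig (Fin n) | 1 ≤ (A.filter fun a => ω ∈ openConnIn ({o}ᶜ : Set (Fin n)) x a).card ∧ (A.filter fun a => ω ∈ openConnIn ({o}ᶜ : Set (Fin n)) x a).card ≤ j}) (wireSet ({o}ᶜ : Set (Fin n))) := by
  rw [determinedBy_iff]
  intro ω ω' hωω'
  have key : ∀ a, (ω ∈ openConnIn ({o}ᶜ : Set (Fin n)) x a ↔ ω' ∈ openConnIn ({o}ᶜ : Set (Fin n)) x a) :=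
    fun a => (determinedBy_iff _ _).1
      (KozmaNitzan.determinedBy_openConnIn_wireSet ({o}ᶜ : Set (Fin n)) x a subset_rfl) ω ω' hωω'
  have hfilt : (A.filter fun a => ω ∈ openConnIn ({o}ᶜ : Set (Fin n)) x a) =
      (A.filter fun a => ω' ∈ openConnIn ({o}ᶜ : Set (Fin n)) x a) :=
    Finset.filter_congr fun a _ => key a
  simp only [mem_setOf_eq, hfilt]

/-- **Independence of the first edge from the off-`o` world**: for `x ≠ o`,
`μ({s(o,x) open} ∩ {1 ≤ N^{off o}_x ≤ j}) = w(o,x) · μ(1 ≤ N^{off o}_x ≤ j)`. [this work] -/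
theorem real_edge_inter_lowerTailOff (w : Sym2 (Fin n) → unitInterval) (A : Finset (Fin n))
    (o x : Fin n) (j : ℕ) :
    (prodBernoulli w).real ({ω : BondConfig (Fin n) | s(o, x) ∈ ω} ∩ {ω : BondConfig (Fin n) | 1 ≤ (A.filter fun a => ω ∈ openConnIn ({o}ᶜ : Set (Fin n)) x a).card ∧ (A.filter fun a => ω ∈ openConnIn ({o}ᶜ : Set (Fin n)) x a).card ≤ j}) =
      (w s(o, x) : ℝ) * (prodBernoulli w).real ({ω : BondConfig (Fin n) | 1 ≤ (A.filter fun a => ω ∈ openConnIn ({o}ᶜ : Set (Fin n)) x a).card ∧ (A.filter fun a => ω ∈ openConnIn ({o}ᶜ : Set (Fin n)) x a).card ≤ j}) := by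
  set F : Finset (Sym2 (Fin n)) := {s(o, x)} with hF
  have hA : DeterminedBy {ω : BondConfig (Fin n) | s(o, x) ∈ ω} (↑F : Set (Sym2 (Fin n))) := by
    rw [determinedBy_iff]
    intro ω ω' hωω'
    have := Set.ext_iff.1 hωω' s(o, x)
    simp only [hF, Finset.coe_singleton, mem_inter_iff, mem_singleton_iff, and_true] at this
    simp only [mem_setOf_eq, this]
  have hB : DeterminedBy ({ω : BondConfig (Fin n) | 1 ≤ (A.filter fun a => ω ∈ openConnIn ({o}ᶜ : Set (Fin n)) x a).card ∧ (A.filter fun a => ω ∈ openConnIn ({o}ᶜ : Set (Fin n)) x a).card ≤ j}) (↑F : Set (Sym2 (Fin n)))ᶜ := by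
    refine (determinedBy_lowerTailOff A o x j).mono fun e he heF => ?_
    rw [hF, Finset.coe_singleton, mem_singleton_iff] at heF
    subst heF
    exact (he.1 o (Sym2.mem_mk_left o x)) rfl
  rw [prodBernoulli_real_inter_of_determinedBy w F hA hB MeasurableSet.of_discrete
    MeasurableSet.of_discrete, prodBernoulli_real_setOf_mem]

/-- **The observer union bound (first-edge form).**  For `o ∉ A` and every level `j`:
`μ(1 ≤ N_o ≤ j) ≤ Σ_{x ≠ o} w(o,x) · μ(1 ≤ N^{off o}_x ≤ j)`. [this work] -/
theorem lowerTail_le_sum_firstEdge (w : Sym2 (Fin n) → unitInterval) (A : Finset (Fin n)) (o : Fin n)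
    (ho : o ∉ A) (j : ℕ) :
    (prodBernoulli w).real ({ω : BondConfig (Fin n) | 1 ≤ (A.filter fun a => ω ∈ openConn o a).card ∧ (A.filter fun a => ω ∈ openConn o a).card ≤ j}) ≤
      ∑ x ∈ (Finset.univ.filter fun x : Fin n => x ≠ o),
        (w s(o, x) : ℝ) * (prodBernoulli w).real ({ω : BondConfig (Fin n) | 1 ≤ (A.filter fun a => ω ∈ openConnIn ({o}ᶜ : Set (Fin n)) x a).card ∧ (A.filter fun a => ω ∈ openConnIn ({o}ᶜ : Set (Fin n)) x a).card ≤ j}) := by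
  calc (prodBernoulli w).real ({ω : BondConfig (Fin n) | 1 ≤ (A.filter fun a => ω ∈ openConn o a).card ∧ (A.filter fun a => ω ∈ openConn o a).card ≤ j})
      ≤ (prodBernoulli w).real (⋃ x ∈ (Finset.univ.filter fun x : Fin n => x ≠ o),
          ({ω : BondConfig (Fin n) | s(o, x) ∈ ω} ∩ {ω : BondConfig (Fin n) | 1 ≤ (A.filter fun a => ω ∈ openConnIn ({o}ᶜ : Set (Fin n)) x a).card ∧ (A.filter fun a => ω ∈ openConnIn ({o}ᶜ : Set (Fin n)) x a).card ≤ j})) :=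
        measureReal_mono (lowerTail_subset_biUnion_firstEdge A o ho j) (measure_ne_top _ _)
    _ ≤ ∑ x ∈ (Finset.univ.filter fun x : Fin n => x ≠ o),
          (prodBernoulli w).real ({ω : BondConfig (Fin n) | s(o, x) ∈ ω} ∩ {ω : BondConfig (Fin n) | 1 ≤ (A.filter fun a => ω ∈ openConnIn ({o}ᶜ : Set (Fin n)) x a).card ∧ (A.filter fun a => ω ∈ openConnIn ({o}ᶜ : Set (Fin n)) x a).card ≤ j}) :=
        measureReal_biUnion_finset_le _ _
    _ = ∑ x ∈ (Finset.univ.filter fun x : Fin n => x ≠ o),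
          (w s(o, x) : ℝ) * (prodBernoulli w).real ({ω : BondConfig (Fin n) | 1 ≤ (A.filter fun a => ω ∈ openConnIn ({o}ᶜ : Set (Fin n)) x a).card ∧ (A.filter fun a => ω ∈ openConnIn ({o}ᶜ : Set (Fin n)) x a).card ≤ j}) :=
        Finset.sum_congr rfl fun x _ => real_edge_inter_lowerTailOff w A o x j

/-- The off-`o` lower tail of `x ≠ o` is the lower tail of `x` in `H = G − o` (`restrW {o}ᶜ w`). [this work] -/
theorem restrW_real_lowerTail (w : Sym2 (Fin n) → unitInterval) (A : Finset (Fin n)) {o x : Fin n}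
    (hxo : x ≠ o) (j : ℕ) :
    (prodBernoulli (restrW ({o}ᶜ : Set (Fin n)) w)).real ({ω : BondConfig (Fin n) | 1 ≤ (A.filter fun a => ω ∈ openConn x a).card ∧ (A.filter fun a => ω ∈ openConn x a).card ≤ j}) =
      (prodBernoulli w).real ({ω : BondConfig (Fin n) | 1 ≤ (A.filter fun a => ω ∈ openConnIn ({o}ᶜ : Set (Fin n)) x a).card ∧ (A.filter fun a => ω ∈ openConnIn ({o}ᶜ : Set (Fin n)) x a).card ≤ j}) := by
  rw [KNGoodAux.restrW_real_eq]
  congr 1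
  ext ω
  have key : ∀ a, (ω ∩ wireSet ({o}ᶜ : Set (Fin n)) ∈ (openConn x a : Set (BondConfig (Fin n))) ↔
      ω ∈ openConnIn ({o}ᶜ : Set (Fin n)) x a) :=
    fun a => KNGoodAux.inter_wireSet_mem_openConn_iff (mem_compl_singleton_iff.2 hxo) a
  have hfilt : (A.filter fun a => ω ∩ wireSet ({o}ᶜ : Set (Fin n)) ∈ (openConn x a : Set (BondConfig (Fin n)))) =
      (A.filter fun a => ω ∈ openConnIn ({o}ᶜ : Set (Fin n)) x a) :=
    Finset.filter_congr fun a _ => key a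
  simp only [mem_setOf_eq, hfilt]

/-- **The observer union bound, `H`-form.**  For `o ∉ A` and every level `j`:
`μ_w(1 ≤ N_o ≤ j) ≤ Σ_{x ≠ o} w(o,x) · μ_{G−o}(1 ≤ N_x ≤ j)`, where `G − o` is `restrW {o}ᶜ w`.
Iterated along a Steiner tree this loses the weighted degree at every level — the baseline that a
depth-uniform proof of the crux must beat (LEAD-GEN6 §3b). [this work] -/
theorem lowerTail_le_sum_firstEdge_restrW (w : Sym2 (Fin n) → unitInterval) (A : Finset (Fin n))
    (o : Fin n) (ho : o ∉ A) (j : ℕ) :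
    (prodBernoulli w).real ({ω : BondConfig (Fin n) | 1 ≤ (A.filter fun a => ω ∈ openConn o a).card ∧ (A.filter fun a => ω ∈ openConn o a).card ≤ j}) ≤
      ∑ x ∈ (Finset.univ.filter fun x : Fin n => x ≠ o),
        (w s(o, x) : ℝ) * (prodBernoulli (restrW ({o}ᶜ : Set (Fin n)) w)).real ({ω : BondConfig (Fin n) | 1 ≤ (A.filter fun a => ω ∈ openConn x a).card ∧ (A.filter fun a => ω ∈ openConn x a).card ≤ j}) := by
  refine (lowerTail_le_sum_firstEdge w A o ho j).trans (le_of_eq ?_)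
  refine Finset.sum_congr rfl fun x hx => ?_
  rw [restrW_real_lowerTail w A (Finset.mem_filter.1 hx).2 j]

end ObserverUnionBound

end

end Summit.CriticalPhenomena.PercolationContinuityZ3.Theorems
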